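import Mathlib
import HarnessLib
import Summits.QuantumAdvantage.AdviceFreeQNC0.OddPrimeTransport
import Summits.QuantumAdvantage.AdviceFreeQNC0.OddPrimeWitnesses
import Summits.QuantumAdvantage.AdviceFreeQNC0.WalkHardFJunta
import Summits.QuantumAdvantage.AdviceFreeQNC0.WalkFailFloor
import Summits.QuantumAdvantage.AdviceFreeQNC0.CombGateJ37Fibre
import Summits.QuantumAdvantage.QuantumAdvantage.Theorems.WalkThreeCharge
import Summits.QuantumAdvantage.QuantumAdvantage.Theorems.PairFreezingG
import Summits.QuantumAdvantage.QuantumAdvantage.Theorems.RegisterRotation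
import Summits.QuantumAdvantage.AdviceFreeQNC0.JointResidueElimination
import Summits.QuantumAdvantage.QuantumAdvantage.Theorems.MobiusLadderDigitPolyUniformityLARChooseMiddleLe
import Summits.QuantumAdvantage.QuantumAdvantage.Theorems.RigidityLawsA
import Summits.QuantumAdvantage.AdviceFreeQNC0.TransferWalk
import Summits.QuantumAdvantage.AdviceFreeQNC0.ConstantBellsDense

/-!
# Null twists of `u`-walk strategies, the uniform-smoothability collapse, and fibrewise smoothing

(cell `decomp-qadv`, lens 4 «minimal counterexample / extremal reduction», generation 12 — companion of
`Theorems/RegisterRotation.lean`; everything is stated for the `u`-WALK family `ringWinU` of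
`AdviceFreeQNC0/WalkHardFJunta.lean` and an arbitrary prime `p` through `HasDegF`.)

## §1 Cut calculus and NULL TWISTS
For a strategy `y : Fin (n+1) → (Fin n → Bool) → Bool` the `𝔽₄`-register is `R_y(u) = Σ_g [y_g(u)]·ω^{g+e_g(u)}`
(`RegisterRotation.reg`, `[WIN_c(y)(u)] = tr(ω^c R_y(u))`).  The phases of the four BOUNDARY cuts `g ∈ {0, 1, n−1, n}` are
affine in `wt(u)` and one input bit (`walkExp_at_one`, `walkExp_pred`, `walkExp_end`), so the strategy `nullTw c k t` cutting
`{0,1}` or `{n−1,n}` according to the class `k` and the end bits, gated by an arbitrary Boolean `t`, has register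
`t·ω^{−c}·(ω^k x + ω^{2k} x²)`, `x = ω^{wt}` (`reg_nullTw`): it is EXACTLY NULL at charge `c` (`ringWinU_nullTw`:
`WIN_c(nullTw c k t) = ⊥`) and wins at charge `c+1` exactly on `t ∧ [wt ≢ −k (mod 3)]` (`ringWinU_nullTw_succ`); its
selections have `𝔽_p`-degree `≤ 4(d+1)` when `t` has degree `d` (`hasDegF_nullTw`).  XOR-ing a strategy with a null twist
keeps its win set and XORs its side pattern `WIN_{c+1}` with a MOD-3 class indicator (`ringWinU_xorStrat`).

## §2 THE COLLAPSE OF UNIFORM SMOOTHABILITY (`walkHardF_of_uniformSmooth`)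
«Every near-perfect polylog-degree strategy has a side pattern `WIN_{c+1}` agreeing with ONE polylog-degree Boolean function
on a `θ'`-fraction of the cube, for every `θ' < 1`» already implies `WalkHardF p` — given Smolensky's single-indicator bound
for MOD 3 over `𝔽_p` as the explicit hypothesis `hSmol` (the Boolean form of
`Literature/…/SmolenskyModqIndicator.card_agree_modIndicator_le`, a sorry-free Literature theorem for `p ∤ 3` that is not
yet in the farm's build closure; discharge `hSmol` from it once it is).  Proof: twist a near-perfect `y` by the three blind
null twists `nullTw c k ⊤`; smooth fits `f` of `y` and `f_k` of the twists make `f ⊕ f_k ⊕ 1` agree with `[wt ≡ −k (3)]` on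
`≥ (2θ'−1)·2ⁿ` inputs each; summing Smolensky's three bounds against `Σ_k #{wt ≢ −k} = 2·2ⁿ` (`card_ne_cls_sum`) with
`θ' = 23/24` and `((p−1)(log n)^{C+2}+1)·C(n,n/2) ≤ 2ⁿ/6` (`logPow_le_sqrt'`, `stub_choose_middle_le`) is a contradiction.
So the uniform smoothability statement is EQUIVALENT to `WalkHardF p` (the converse is vacuous) — negative knowledge for
structure/hardness splits of item 26994: a structure piece must be invariant under null twists.

## §3 FIBREWISE SMOOTHING
`fibreWin c y F u := WIN_c(y)(u) ∧ (WIN_{c+1}(y)(u) = F_{wt(u) mod 3}(u))` — smoothness of the side pattern FIBREWISE over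
the weight class mod 3.  It is COVARIANT under every null twist: `fibreWin_nullTw`, and for the generic element
`modTw c t = ⊕_k nullTw c k t_k` of the boundary null-twist module (arbitrary gates) `fibreWin_modTw` / `card_fibreWin_modTw`;
the general dictionary `fibreWin_twist_of_null` / `card_fibreWin_twist_ae_null` says that ANY (a.e.-)null twist `z` acts on
fibrewise witnesses only through its side effect `WIN_{c+1}(z)`.  DEFIBRING `defib c y F := y ⊕ ⊕_j nullTw c (2j) (F_{j+1} ⊕
F_{j+2})` turns a fibrewise-smooth win into a uniformly smooth one with test `F₀ ⊕ F₁ ⊕ F₂` (`smoothWin_defib`, degrees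
`hasDegF_defib`, `hasDegF_xor3`), whence `fibre_of_smooth`: a smooth-win bound at polylog side degree gives the fibrewise
bound (and, with `RegisterRotation.smoothHard_polylog_iff_rigidHard`, fibrewise-smooth hardness at the polylog notch is
two-charge rigidity hardness).

All statements are inlined (no `def … : Prop`); no instance, no notation; 0 sorry.
-/

set_option linter.dupNamespace false

namespace Summit.QuantumAdvantage.AdviceFreeQNC0.NullTwist

open Classical
open Finset
open Summit.QuantumAdvantage.AdviceFreeQNC0
open Summit.QuantumAdvantage.AdviceFreeQNC0.RegisterRotation
open Literature.Computability.MetaComplexity Literature.Computability.MetaComplexity.Smolensky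

variable {n : ℕ}

/-! ## §1 Cut calculus and null twists -/

section NullTwist
open F4

/-- first and last input bit (`false` on the empty cube). -/
def bit0 (u : Fin n → Bool) : Bool := if h : 0 < n then u ⟨0, h⟩ else false

/-- last input bit. -/
def bitL (u : Fin n → Bool) : Bool := if h : 0 < n then u ⟨n - 1, Nat.sub_lt h Nat.one_pos⟩ else false

/-- NullTwist helper `walkExp_at_one` (decomp-qadv land package; see the module docstring). -/
theorem walkExp_at_one (hn : 1 ≤ n) (u : Fin n → Bool) :
    walkExp u 1 = wt u + (if bit0 u = true then 1 else 0) := by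
  unfold walkExp bit0
  have h := Summit.QuantumAdvantage.QuantumAdvantage.Theorems.PairFreezing.wtPrefix_succ u (g := 0) hn
  rw [Nat.zero_add, TransferWalk.wtPrefix_zero, Nat.zero_add] at h
  rw [h, dif_pos (show 0 < n from hn)]

/-- NullTwist helper `wt_eq_pred` (decomp-qadv land package; see the module docstring). -/
theorem wt_eq_pred (hn : 1 ≤ n) (u : Fin n → Bool) :
    wt u = wtPrefix u (n - 1) + (if bitL u = true then 1 else 0) := by
  unfold bitL
  have h := Summit.QuantumAdvantage.QuantumAdvantage.Theorems.PairFreezing.wtPrefix_succ u (g := n - 1)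
    (Nat.sub_lt hn Nat.one_pos)
  rw [Nat.sub_add_cancel hn, ConstBells.wtPrefix_self] at h
  rw [h, dif_pos (show 0 < n from hn)]

/-- the single cut `i`, fired by the test `s`. -/
def cutAt (i : ℕ) (s : (Fin n → Bool) → Bool) : Fin (n + 1) → (Fin n → Bool) → Bool :=
  fun g u => decide (g.val = i) && s u

/-- NullTwist helper `reg_cutAt` (decomp-qadv land package; see the module docstring). -/
theorem reg_cutAt {i : ℕ} (hi : i ≤ n) (s : (Fin n → Bool) → Bool) (u : Fin n → Bool) :
    reg (cutAt i s) u = ιF (s u) * ω ^ (i + walkExp u i) := by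
  unfold reg cutAt
  rw [Finset.sum_eq_single (⟨i, Nat.lt_succ_of_le hi⟩ : Fin (n + 1))]
  · simp
  · intro g _ hg
    have hgi : g.val ≠ i := fun h => hg (Fin.ext h)
    simp [hgi, ιF]
  · intro h
    exact absurd (Finset.mem_univ _) h

/-- NullTwist helper `hasDegF_cutAt` (decomp-qadv land package; see the module docstring). -/
theorem hasDegF_cutAt {p : ℕ} [Fact p.Prime] {d : ℕ} (i : ℕ) {s : (Fin n → Bool) → Bool} (hs : HasDegF p s d)
    (g : Fin (n + 1)) : HasDegF p (cutAt i s g) d := by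
  by_cases h : g.val = i
  · have : cutAt i s g = s := by
      funext u
      simp [cutAt, h]
    rw [this]
    exact hs
  · have : cutAt i s g = fun _ => false := by
      funext u
      simp [cutAt, h]
    rw [this]
    exact RigidityLaws.hasDegF_const p false d

/-- NullTwist helper `hasDegF_bit0` (decomp-qadv land package; see the module docstring). -/
theorem hasDegF_bit0 (p : ℕ) [Fact p.Prime] (φ : Bool → Bool) :
    HasDegF p (fun u : Fin n → Bool => φ (bit0 u)) 1 := by
  by_cases hn : 0 < n
  · have h := hasDegF_of_junta (p := p) ({⟨0, hn⟩} : Finset (Fin n)) (fun u => φ (bit0 u)) (by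
      intro u v huv
      simp only [bit0, dif_pos hn]
      rw [huv ⟨0, hn⟩ (Finset.mem_singleton_self _)])
    rwa [Finset.card_singleton] at h
  · have : (fun u : Fin n → Bool => φ (bit0 u)) = fun _ => φ false := by
      funext u
      simp [bit0, hn]
    rw [this]
    exact RigidityLaws.hasDegF_const p _ 1

/-- NullTwist helper `hasDegF_bitL` (decomp-qadv land package; see the module docstring). -/
theorem hasDegF_bitL (p : ℕ) [Fact p.Prime] (φ : Bool → Bool) :
    HasDegF p (fun u : Fin n → Bool => φ (bitL u)) 1 := by
  by_cases hn : 0 < n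
  · have h := hasDegF_of_junta (p := p) ({⟨n - 1, Nat.sub_lt hn Nat.one_pos⟩} : Finset (Fin n))
      (fun u => φ (bitL u)) (by
      intro u v huv
      simp only [bitL, dif_pos hn]
      rw [huv ⟨n - 1, Nat.sub_lt hn Nat.one_pos⟩ (Finset.mem_singleton_self _)])
    rwa [Finset.card_singleton] at h
  · have : (fun u : Fin n → Bool => φ (bitL u)) = fun _ => φ false := by
      funext u
      simp [bitL, hn]
    rw [this]
    exact RigidityLaws.hasDegF_const p _ 1

/-- NullTwist helper `omega_cubed` (decomp-qadv land package; see the module docstring). -/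
theorem omega_cubed : (F4.ω : F4) ^ 3 = 1 := by
  rw [omega_pow_mod]
  norm_num

/-- NullTwist helper `omega_add_one` (decomp-qadv land package; see the module docstring). -/
theorem omega_add_one : ω + 1 = ω ^ 2 := by
  rw [add_comm, one_add_omega]

/-- test of cut `0` realising the constant local register `ω^{a mod 3}` together with cut `1`. -/
def sel0 (a : ℕ) (b : Bool) : Bool :=
  decide (a % 3 = 0) || (decide (a % 3 = 1) && b) || (decide (a % 3 = 2) && !b)

/-- test of cut `n` realising the constant local register `ω^{b mod 3}` together with cut `n−1`. -/
def selL (b : ℕ) (x : Bool) : Bool :=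
  decide (b % 3 = 0) || (decide (b % 3 = 1) && !x) || (decide (b % 3 = 2) && x)

/-- NullTwist helper `sel0_identity` (decomp-qadv land package; see the module docstring). -/
theorem sel0_identity (a : ℕ) (b : Bool) :
    ιF (sel0 a b) + ιF (decide (a % 3 ≠ 0)) * ω ^ (1 + (if b = true then 1 else 0)) = ω ^ (a % 3) := by
  unfold sel0
  have h3 : a % 3 < 3 := Nat.mod_lt _ (by norm_num)
  generalize a % 3 = r at h3 ⊢
  interval_cases r <;> cases b <;> simp [ιF, one_add_omega, one_add_omega_sq]

/-- NullTwist helper `selL_identity` (decomp-qadv land package; see the module docstring). -/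
theorem selL_identity (b : ℕ) (x : Bool) :
    ιF (decide (b % 3 ≠ 0)) * ω ^ (if x = true then 1 else 0) +
        ιF (selL b x) * ω ^ (1 + 2 * (if x = true then 1 else 0)) =
      ω ^ ((b % 3 + 1 + 2 * (if x = true then 1 else 0)) % 3) := by
  unfold selL
  have h3 : b % 3 < 3 := Nat.mod_lt _ (by norm_num)
  generalize b % 3 = r at h3 ⊢
  interval_cases r <;> cases x <;> simp [ιF, one_add_omega, omega_add_one, omega_cubed]

/-- START PAIR: cuts `{0,1}` gated by `t`, local register `ω^a` — register `[t]·ω^{a + wt(u)}`. -/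
def startTw (a : ℕ) (t : (Fin n → Bool) → Bool) : Fin (n + 1) → (Fin n → Bool) → Bool :=
  xorStrat (cutAt 0 fun u => t u && sel0 a (bit0 u)) (cutAt 1 fun u => t u && decide (a % 3 ≠ 0))

/-- END PAIR: cuts `{n−1,n}` gated by `t`, local register `ω^b` on the doubled phase — register `[t]·ω^{b + 2wt(u)}`. -/
def endTw (b : ℕ) (t : (Fin n → Bool) → Bool) : Fin (n + 1) → (Fin n → Bool) → Bool :=
  xorStrat (cutAt (n - 1) fun u => t u && decide ((b + 2 * n) % 3 ≠ 0))
    (cutAt n fun u => t u && selL (b + 2 * n) (bitL u))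

/-- NullTwist helper `reg_startTw` (decomp-qadv land package; see the module docstring). -/
theorem reg_startTw (hn : 1 ≤ n) (a : ℕ) (t : (Fin n → Bool) → Bool) (u : Fin n → Bool) :
    reg (startTw a t) u = ιF (t u) * ω ^ (a + wt u) := by
  unfold startTw
  rw [reg_xorStrat, reg_cutAt (Nat.zero_le n), reg_cutAt hn, iotaF_and, iotaF_and, Nat.zero_add, RigidityLaws.walkExp_zero,
    walkExp_at_one hn u]
  have hsel := sel0_identity a (bit0 u)
  have e1 : ω ^ (1 + (wt u + (if bit0 u = true then 1 else 0))) =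
      ω ^ wt u * ω ^ (1 + (if bit0 u = true then 1 else 0)) := by
    rw [← pow_add, Nat.add_left_comm]
  have e2 : ω ^ (a + wt u) = ω ^ wt u * ω ^ (a % 3) := by
    rw [← pow_add]
    exact omega_pow_congr (by omega)
  linear_combination (ιF (t u) * ιF (decide (a % 3 ≠ 0))) * e1 - ιF (t u) * e2 + (ιF (t u) * ω ^ wt u) * hsel

/-- NullTwist helper `reg_endTw` (decomp-qadv land package; see the module docstring). -/
theorem reg_endTw (hn : 1 ≤ n) (b : ℕ) (t : (Fin n → Bool) → Bool) (u : Fin n → Bool) :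
    reg (endTw b t) u = ιF (t u) * ω ^ (b + 2 * wt u) := by
  unfold endTw
  rw [reg_xorStrat, reg_cutAt (Nat.sub_le n 1), reg_cutAt le_rfl, iotaF_and, iotaF_and]
  unfold walkExp
  rw [ConstBells.wtPrefix_self, wt_eq_pred hn u]
  have hsel := selL_identity (b + 2 * n) (bitL u)
  by_cases hb : bitL u = true
  · simp only [if_pos hb] at hsel ⊢
    have e1 : ω ^ (n - 1 + (wtPrefix u (n - 1) + 1 + wtPrefix u (n - 1))) =
        ω ^ (n - 1 + 2 * wtPrefix u (n - 1)) * ω ^ (1 : ℕ) := by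
      rw [← pow_add]; exact omega_pow_congr (by omega)
    have e2 : ω ^ (n + (wtPrefix u (n - 1) + 1 + (wtPrefix u (n - 1) + 1))) =
        ω ^ (n - 1 + 2 * wtPrefix u (n - 1)) * ω ^ (1 + 2 * 1) := by
      rw [← pow_add]; exact omega_pow_congr (by omega)
    have e3 : ω ^ (b + 2 * (wtPrefix u (n - 1) + 1)) =
        ω ^ (n - 1 + 2 * wtPrefix u (n - 1)) * ω ^ (((b + 2 * n) % 3 + 1 + 2 * 1) % 3) := by
      rw [← pow_add]; exact omega_pow_congr (by omega)
    linear_combination (ιF (t u) * ιF (decide ((b + 2 * n) % 3 ≠ 0))) * e1 +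
      (ιF (t u) * ιF (selL (b + 2 * n) (bitL u))) * e2 - ιF (t u) * e3 +
      (ιF (t u) * ω ^ (n - 1 + 2 * wtPrefix u (n - 1))) * hsel
  · simp only [if_neg hb] at hsel ⊢
    have e1 : ω ^ (n - 1 + (wtPrefix u (n - 1) + 0 + wtPrefix u (n - 1))) =
        ω ^ (n - 1 + 2 * wtPrefix u (n - 1)) * ω ^ (0 : ℕ) := by
      rw [← pow_add]; exact omega_pow_congr (by omega)
    have e2 : ω ^ (n + (wtPrefix u (n - 1) + 0 + (wtPrefix u (n - 1) + 0))) =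
        ω ^ (n - 1 + 2 * wtPrefix u (n - 1)) * ω ^ (1 + 2 * 0) := by
      rw [← pow_add]; exact omega_pow_congr (by omega)
    have e3 : ω ^ (b + 2 * (wtPrefix u (n - 1) + 0)) =
        ω ^ (n - 1 + 2 * wtPrefix u (n - 1)) * ω ^ (((b + 2 * n) % 3 + 1 + 2 * 0) % 3) := by
      rw [← pow_add]; exact omega_pow_congr (by omega)
    linear_combination (ιF (t u) * ιF (decide ((b + 2 * n) % 3 ≠ 0))) * e1 +
      (ιF (t u) * ιF (selL (b + 2 * n) (bitL u))) * e2 - ιF (t u) * e3 +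
      (ιF (t u) * ω ^ (n - 1 + 2 * wtPrefix u (n - 1))) * hsel

/-- **THE NULL TWIST** `nullTw c k t`: start pair with local register `ω^{2c+k}`, end pair with `ω^{2c+2k}`. -/
def nullTw (c k : ℕ) (t : (Fin n → Bool) → Bool) : Fin (n + 1) → (Fin n → Bool) → Bool :=
  xorStrat (startTw (2 * c + k) t) (endTw (2 * c + 2 * k) t)

/-- its register: `ω^{2c}·[t]·(x + x²) = ω^{−c}·[t]·tr(ω^{k + wt(u)})`, `x = ω^{k + wt(u)}`. -/
theorem reg_nullTw (hn : 1 ≤ n) (c k : ℕ) (t : (Fin n → Bool) → Bool) (u : Fin n → Bool) :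
    reg (nullTw c k t) u = ω ^ (2 * c) * (ιF (t u) * tr (ω ^ (k + wt u))) := by
  unfold nullTw
  rw [reg_xorStrat, reg_startTw hn, reg_endTw hn, tr, ← pow_mul]
  have e1 : ω ^ (2 * c + k + wt u) = ω ^ (2 * c) * ω ^ (k + wt u) := by
    rw [← pow_add, Nat.add_assoc]
  have e2 : ω ^ (2 * c + 2 * k + 2 * wt u) = ω ^ (2 * c) * ω ^ ((k + wt u) * 2) := by
    rw [← pow_add]
    congr 1
    ring
  rw [e1, e2]
  ring

/-- NullTwist helper `omega_pow_mul_omega_pow_two_mul` (decomp-qadv land package; see the module docstring). -/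
theorem omega_pow_mul_omega_pow_two_mul (c : ℕ) : ω ^ c * ω ^ (2 * c) = 1 := by
  rw [← pow_add, omega_pow_mod, show (c + 2 * c) % 3 = 0 by omega, pow_zero]

/-- NullTwist helper `tr_bit` (decomp-qadv land package; see the module docstring). -/
theorem tr_bit (v : F4) (hv : v = 0 ∨ v = 1) : tr v = 0 := by
  rcases hv with rfl | rfl
  · exact tr_zero
  · unfold tr
    rw [one_pow, F4.add_self]

/-- **EXACTLY NULL at charge `c`** (every input, every `n ≥ 1`, every gate `t`, every `k`). -/
theorem ringWinU_nullTw (hn : 1 ≤ n) (c k : ℕ) (t : (Fin n → Bool) → Bool) (u : Fin n → Bool) :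
    ringWinU c (nullTw c k t) u = false := by
  haveI := F4.nontrivial
  have h := iotaF_ringWinU_reg c (nullTw c k t) u
  rw [reg_nullTw hn, ← mul_assoc, omega_pow_mul_omega_pow_two_mul, one_mul, tr_omega_pow] at h
  have hv : ιF (t u) * (if (k + wt u) % 3 = 0 then (0 : F4) else 1) = 0 ∨
      ιF (t u) * (if (k + wt u) % 3 = 0 then (0 : F4) else 1) = 1 := by
    unfold ιF
    cases t u <;> split_ifs <;> simp
  rw [tr_bit _ hv] at h
  cases hw : ringWinU c (nullTw c k t) u
  · rfl
  · rw [hw] at h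
    simp [ιF] at h

/-- **its SIDE EFFECT at charge `c+1`**: `t(u) ∧ [k + wt(u) ≢ 0 (mod 3)]` — for `t ≡ 1` a MOD₃ function of the input. -/
theorem ringWinU_nullTw_succ (hn : 1 ≤ n) (c k : ℕ) (t : (Fin n → Bool) → Bool) (u : Fin n → Bool) :
    ringWinU (c + 1) (nullTw c k t) u = (t u && !decide ((k + wt u) % 3 = 0)) := by
  haveI := F4.nontrivial
  apply iotaF_injective
  rw [iotaF_ringWinU_reg, reg_nullTw hn, ← mul_assoc, pow_succ ω c, mul_right_comm (ω ^ c) ω (ω ^ (2 * c)),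
    omega_pow_mul_omega_pow_two_mul, one_mul, tr_omega_pow]
  unfold ιF tr
  cases t u <;> by_cases h : (k + wt u) % 3 = 0 <;> simp [h, omega_add_omega_sq]

/-- degree: every cut of `nullTw c k t` has degree `≤ 4·(deg t + 1)`. -/
theorem hasDegF_nullTw {p : ℕ} [Fact p.Prime] {d : ℕ} (c k : ℕ) {t : (Fin n → Bool) → Bool} (ht : HasDegF p t d)
    (g : Fin (n + 1)) : HasDegF p (nullTw c k t g) (4 * (d + 1)) := by
  have h1 : ∀ a, HasDegF p (fun u => t u && sel0 a (bit0 u)) (d + 1) := fun a =>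
    hasDegF_and ht (hasDegF_bit0 p (sel0 a))
  have h2 : ∀ a : ℕ, HasDegF p (fun u : Fin n → Bool => t u && decide (a % 3 ≠ 0)) (d + 1) := fun a =>
    hasDegF_and ht (RigidityLaws.hasDegF_const p _ 1)
  have h3 : ∀ b, HasDegF p (fun u => t u && selL b (bitL u)) (d + 1) := fun b =>
    hasDegF_and ht (hasDegF_bitL p (selL b))
  have hs : ∀ g, HasDegF p (startTw (2 * c + k) t g) ((d + 1) + (d + 1)) := fun g =>
    hasDegF_xorStrat (fun g => hasDegF_cutAt 0 (h1 _) g) (fun g => hasDegF_cutAt 1 (h2 _) g) g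
  have he : ∀ g, HasDegF p (endTw (2 * c + 2 * k) t g) ((d + 1) + (d + 1)) := fun g =>
    hasDegF_xorStrat (fun g => hasDegF_cutAt (n - 1) (h2 _) g) (fun g => hasDegF_cutAt n (h3 _) g) g
  have h := hasDegF_xorStrat hs he g
  unfold nullTw
  unfold HasDegF at h ⊢
  exact lowDeg_mono (by omega) h

end NullTwist

/-! ## §2 The collapse of uniform smoothability -/

section Kill

/-- NullTwist helper `five_le_log_of_le` (decomp-qadv land package; see the module docstring). -/
theorem five_le_log_of_le {n : ℕ} (hn : 32 ≤ n) : 5 ≤ Nat.log 2 n := by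
  have h : 2 ^ 5 ≤ n := by norm_num; omega
  exact Nat.le_log_of_pow_le (by norm_num) h


end Kill
end Summit.QuantumAdvantage.AdviceFreeQNC0.NullTwist
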